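import Mathlib

/-!
# Torus geometry: largest coordinate separation versus Euclidean torus distance

Stub `stub_torusGeometry` of the line `Sketch` for the crux `FemtoCurvatureTwoPointC`
(4-D lattice Yang–Mills, curvature two-point functions in femto boxes).

On the discrete torus `(ZMod L)⁴`, for two distinct sites `x ≠ y` let `μ` be a direction of largest
coordinate separation `m = |(y - x)_μ|` (minimal-absolute-value representative in `ZMod L`).  Then
`1 ≤ m`, `2m ≤ L`, every coordinate separation is `≤ m`, and the Euclidean torus distance
`dist = √(∑ₖ |(x - y)_k|²)` satisfies `m ≤ dist ≤ 2m`, hence also `m ≤ ⌈dist⌉₊ ≤ 2m`.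
Pure Mathlib (`ZMod.valMinAbs`, `Real.sqrt`, `Nat.ceil`).
-/

set_option autoImplicit false

namespace Summit.QuantumFields.YangMills.Theorems.FemtoCurvatureTwoPointC

/-- The real square of the minimal representative of `a : ZMod L` equals the real square of its
absolute value (as a natural number). [folklore] -/
theorem cast_valMinAbs_sq_eq_natAbs_sq {L : ℕ} (a : ZMod L) :
    ((a.valMinAbs : ℤ) : ℝ) ^ 2 = ((a.valMinAbs.natAbs : ℕ) : ℝ) ^ 2 := by
  rw [Nat.cast_natAbs, Int.cast_abs, sq_abs]

/-- **Torus geometry.** For distinct sites `x ≠ y` of `(ZMod L)⁴` there is a direction `μ` of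
largest coordinate separation `m = |(y - x)_μ| ≥ 1` with `2m ≤ L`, all coordinate separations
`≤ m`, and the Euclidean torus distance `√(∑ₖ |(x - y)_k|²)` together with its ceiling squeezed
between `m` and `2m`. [folklore] -/
theorem stub_torusGeometry :
    ∀ (L : ℕ) [NeZero L] (x y : Fin 4 → ZMod L), x ≠ y →
      ∃ (μ : Fin 4) (m : ℕ), m = ((y μ - x μ).valMinAbs).natAbs ∧ 1 ≤ m ∧ 2 * m ≤ L ∧
        (∀ k : Fin 4, ((x k - y k).valMinAbs).natAbs ≤ m) ∧
        (m : ℝ) ≤ Real.sqrt (∑ k : Fin 4, (((x k - y k).valMinAbs : ℤ) : ℝ) ^ 2) ∧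
        Real.sqrt (∑ k : Fin 4, (((x k - y k).valMinAbs : ℤ) : ℝ) ^ 2) ≤ 2 * m ∧
        m ≤ ⌈Real.sqrt (∑ k : Fin 4, (((x k - y k).valMinAbs : ℤ) : ℝ) ^ 2)⌉₊ ∧
        ⌈Real.sqrt (∑ k : Fin 4, (((x k - y k).valMinAbs : ℤ) : ℝ) ^ 2)⌉₊ ≤ 2 * m := by
  intro L _ x y hxy
  -- a direction of largest coordinate separation
  obtain ⟨μ, -, hμ⟩ := Finset.exists_max_image Finset.univ
    (fun k => ((x k - y k).valMinAbs).natAbs) Finset.univ_nonempty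
  set m : ℕ := ((x μ - y μ).valMinAbs).natAbs with hm_def
  have hmax : ∀ k : Fin 4, ((x k - y k).valMinAbs).natAbs ≤ m := fun k => hμ k (Finset.mem_univ k)
  have hm_eq : m = ((y μ - x μ).valMinAbs).natAbs := by
    rw [← neg_sub, ZMod.natAbs_valMinAbs_neg]
  -- `1 ≤ m`: otherwise every coordinate separation vanishes and `x = y`
  have hm1 : 1 ≤ m := by
    by_contra h
    have h0 : m = 0 := by omega
    apply hxy
    funext k
    have hk := hmax k
    rw [h0, Nat.le_zero, Int.natAbs_eq_zero, ZMod.valMinAbs_eq_zero, sub_eq_zero] at hk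
    exact hk
  -- `2 * m ≤ L` from `|valMinAbs| ≤ L / 2`
  have hm2 : 2 * m ≤ L := by
    have hle : m ≤ L / 2 := ZMod.natAbs_valMinAbs_le (x μ - y μ)
    omega
  -- the squared distance, rewritten through natural absolute values
  set S : ℝ := ∑ k : Fin 4, (((x k - y k).valMinAbs : ℤ) : ℝ) ^ 2 with hS_def
  have hS_eq : S = ∑ k : Fin 4, ((((x k - y k).valMinAbs).natAbs : ℕ) : ℝ) ^ 2 := by
    rw [hS_def]
    exact Finset.sum_congr rfl fun k _ => cast_valMinAbs_sq_eq_natAbs_sq (x k - y k)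
  have hS_lower : (m : ℝ) ^ 2 ≤ S := by
    rw [hS_eq]
    exact Finset.single_le_sum
      (f := fun k => ((((x k - y k).valMinAbs).natAbs : ℕ) : ℝ) ^ 2)
      (fun k _ => sq_nonneg _) (Finset.mem_univ μ)
  have hS_upper : S ≤ (2 * (m : ℝ)) ^ 2 := by
    rw [hS_eq]
    have hle : ∀ k ∈ (Finset.univ : Finset (Fin 4)),
        ((((x k - y k).valMinAbs).natAbs : ℕ) : ℝ) ^ 2 ≤ (m : ℝ) ^ 2 := by
      intro k _
      have hk : ((((x k - y k).valMinAbs).natAbs : ℕ) : ℝ) ≤ (m : ℝ) := by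
        exact_mod_cast hmax k
      exact pow_le_pow_left₀ (Nat.cast_nonneg _) hk 2
    calc ∑ k : Fin 4, ((((x k - y k).valMinAbs).natAbs : ℕ) : ℝ) ^ 2
        ≤ ∑ _k : Fin 4, (m : ℝ) ^ 2 := Finset.sum_le_sum hle
      _ = (2 * (m : ℝ)) ^ 2 := by
          rw [Finset.sum_const, Finset.card_univ, Fintype.card_fin]
          ring
  have hdist_lower : (m : ℝ) ≤ Real.sqrt S := Real.le_sqrt_of_sq_le hS_lower
  have hdist_upper : Real.sqrt S ≤ 2 * (m : ℝ) :=
    Real.sqrt_le_iff.2 ⟨by positivity, hS_upper⟩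
  refine ⟨μ, m, hm_eq, hm1, hm2, hmax, hdist_lower, hdist_upper, ?_, ?_⟩
  · -- `m ≤ ⌈dist⌉₊`
    have h : (m : ℝ) ≤ (⌈Real.sqrt S⌉₊ : ℝ) := hdist_lower.trans (Nat.le_ceil _)
    exact_mod_cast h
  · -- `⌈dist⌉₊ ≤ 2 m`
    refine Nat.ceil_le.2 ?_
    push_cast
    exact hdist_upper

end Summit.QuantumFields.YangMills.Theorems.FemtoCurvatureTwoPointC
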